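import Summits.NavierStokesRegularity.NavierStokesRegularity.Theorems.TypeICertificateLadderTargetRssCompactnessLimit
import HarnessLib

/-!
# Compactness of Type I RDSS solutions with factors `λ_n ↓ 1`: the extraction step

Summit `NavierStokesRegularity`, crux `TypeICertificateLadder.NoTypeIBlowup`, line
`killing-twisted-bernoulli-solitons`. The Chae–Wolf 2017, §3 compactness argument for rotated
discretely self-similar (RDSS, Pineau–Vicol 2026, (1.13)) Type I classical Navier–Stokes
solutions `w_n = pvAnsatz α_n U_n` whose profiles are `s`-periodic with periods `2 log c_n`,
factors `c_n ↓ 1`, rotation speeds `α_n → α₀` and a common Type I constant `C₀`: a subsequence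
converges locally uniformly on `(−∞, −1/4] × ℝ³` to a continuous Type I bounded weak solution which
is RSS-symmetric with speed `α₀` — `v(t,x) = μ R(2α₀ log μ) v(μ²t, μ R(−2α₀ log μ) x)` for every
`μ ≥ 1`, because `w_n` is rotated-DSS with every factor `c_n^k` (`isRotatedDSS_pvAnsatz` for the
`2 log (c_n^k)`-periodic profile) and `c_n^{k_n} → μ` for suitable exponents — and nontrivial at
time `−1` (Step 1: the periodicity of the profile moves a point of large scale-invariant size into
one period, `t_n ∈ [−c_n², −1]`, and these witnesses accumulate at a point `(−1, x̄)`). This is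
the sibling `rssCompact_exists_limit` (RSS, fixed factor `μ`) with moving factors, i.e. the tree's
`ChaeWolf.exists_limit` (DSS, no rotation) with the rotations kept in the limit.

## References

* D. Chae, J. Wolf, *Removing discretely self-similar singularities for the 3D Navier–Stokes
  equations*, Comm. PDE 42 (2017) 1359–1374 = arXiv:1610.09464, §3 (Steps 1–2).
* B. Pineau, V. Vicol, *On rotated backwards self-similar solutions of the incompressible 3D
  Navier–Stokes equations*, arXiv:2607.09619 (2026), §1.4 (1.13), Remark 1.5, Theorem 1.7.
-/

set_option linter.dupNamespace false

noncomputable section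

open Set Function Filter MeasureTheory Metric
open scoped Topology NNReal

namespace Summit.NavierStokesRegularity.NavierStokesRegularity.Theorems

open Literature.Analysis.FluidPDE Literature.Analysis.FluidPDE.PineauVicol2026

/-! ### Rotated discrete self-similarity of the RDSS ansatz with the iterated factors -/

/-- The RDSS ansatz field with a `2 log c`-periodic profile is rotated-DSS with every factor
`μ = c ^ k`: `w(t,x) = μ R(θ) w(μ²t, μ R(−θ) x)`, `θ = 2α log μ` (a `2 log c`-periodic profile is
`2 log (c ^ k)`-periodic; the tree's `isRotatedDSS_pvAnsatz`). -/
private theorem rdssCompact_pvAnsatz_eq_smul_rotZ_pow (α : ℝ) {c : ℝ} (hc : 0 < c)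
    {U : EuclideanSpace ℝ (Fin 3) → ℝ → EuclideanSpace ℝ (Fin 3)}
    (hper : ∀ (y : EuclideanSpace ℝ (Fin 3)) (s : ℝ), U y (s + 2 * Real.log c) = U y s)
    (k : ℕ) (t : ℝ) (x : EuclideanSpace ℝ (Fin 3)) :
    pvAnsatz α U t x = c ^ k • rotZ (α * (2 * Real.log (c ^ k)))
      (pvAnsatz α U ((c ^ k) ^ 2 * t) (c ^ k • rotZ (-(α * (2 * Real.log (c ^ k)))) x)) := by
  -- adapted from Literature/Analysis/FluidPDE/PineauVicolRSSHolds.lean (pvAnsatz_rss_eq_smul_rotZ)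
  have hperk : ∀ (y : EuclideanSpace ℝ (Fin 3)) (s : ℝ),
      U y (s + 2 * Real.log (c ^ k)) = U y s := fun y s => by
    rw [show s + 2 * Real.log (c ^ k) = s + k * (2 * Real.log c) by rw [Real.log_pow]; ring]
    exact profile_add_nat_mul_period hper y s k
  have h := isRotatedDSS_pvAnsatz (α := α) (pow_pos hc k) hperk t x
  simp only [rotZLIE_symm_apply, rotZLIE_apply, neg_neg] at h
  exact h.symm

/-! ### Step 1 for rotated-DSS fields: a witness of nontriviality in one period -/

/-- **Chae–Wolf 2017, §3, Step 1, with rotations.** From a point where the scale-invariant size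
`√(−t')‖w(t',x')‖ = ‖U(y', s')‖` of the RDSS ansatz field exceeds `ε₀`, the periodicity of the
profile moves the self-similar time `s'` into the period `[−2 log c, 0)`, i.e. to a time
`t ∈ [−c², −1]`, at a rotated and rescaled point of the same size; for `c ≤ 2` the Type I bound
then confines the point to `‖x‖ ≤ 2C₀/ε₀` and gives `‖w(t,x)‖ ≥ ε₀/2`
(`ChaeWolf.witness_of_point`). -/
private theorem rdssCompact_witness {ε₀ C₀ α c : ℝ}
    {U : EuclideanSpace ℝ (Fin 3) → ℝ → EuclideanSpace ℝ (Fin 3)} (hε₀ : 0 < ε₀) (hC₀ : 0 ≤ C₀)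
    (hc1 : 1 < c) (hc2 : c ≤ 2)
    (hper : ∀ (y : EuclideanSpace ℝ (Fin 3)) (s : ℝ), U y (s + 2 * Real.log c) = U y s)
    (hI : HasTypeIDecay C₀ (pvAnsatz α U)) {t' : ℝ} (ht' : t' < 0)
    {x' : EuclideanSpace ℝ (Fin 3)} (hq' : ε₀ < √(-t') * ‖pvAnsatz α U t' x'‖) :
    ∃ t ∈ Icc (-c ^ 2) (-1), ∃ x : EuclideanSpace ℝ (Fin 3),
      ‖x‖ ≤ 2 * C₀ / ε₀ ∧ ε₀ / 2 ≤ ‖pvAnsatz α U t x‖ := by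
  -- adapted from Literature/Analysis/FluidPDE/ChaeWolfRemovingDSSLimit.lean (exists_witness)
  have hc0 : 0 < c := one_pos.trans hc1
  have hS : 0 < 2 * Real.log c := mul_pos two_pos (Real.log_pos hc1)
  -- the size in terms of the profile: `√(-t') ‖w t' x'‖ = ‖U y' s'‖`
  have hs' : 0 < √(-t') := Real.sqrt_pos.2 (by linarith)
  set y' : EuclideanSpace ℝ (Fin 3) :=
    rotZ (-(α * -Real.log (-t'))) ((√(-t'))⁻¹ • x') with hy'
  have hUy : ε₀ < ‖U y' (-Real.log (-t'))‖ := by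
    have e : √(-t') * ‖pvAnsatz α U t' x'‖ = ‖U y' (-Real.log (-t'))‖ := by
      rw [norm_pvAnsatz, ← mul_assoc, mul_inv_cancel₀ hs'.ne', one_mul]
    rwa [e] at hq'
  -- move the self-similar time into the period `[-2 log c, 0)`
  have hP : Function.Periodic (fun s => U y' s) (2 * Real.log c) := fun s => hper y' s
  obtain ⟨s, hs, hUs⟩ := hP.exists_mem_Ico hS (-Real.log (-t')) (-(2 * Real.log c))
  rw [neg_add_cancel] at hs
  have hUs' : U y' (-Real.log (-t')) = U y' s := hUs
  set t : ℝ := -Real.exp (-s) with ht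
  have hlog : -Real.log (-t) = s := by rw [ht, neg_neg, Real.log_exp, neg_neg]
  have hr : 0 < √(-t) := Real.sqrt_pos.2 (by rw [ht, neg_neg]; exact Real.exp_pos _)
  have htI : t ∈ Icc (-c ^ 2) (-1) := by
    have h1 : Real.exp (-s) ≤ c ^ 2 := by
      rw [← Real.exp_log (pow_pos hc0 2), Real.exp_le_exp, Real.log_pow]
      push_cast
      linarith [hs.1]
    have h2 : 1 ≤ Real.exp (-s) := Real.one_le_exp_iff.2 (by linarith [hs.2])
    exact ⟨by linarith [ht, h1], by linarith [ht, h2]⟩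
  refine ⟨t, htI, √(-t) • rotZ (α * s) y', ChaeWolf.witness_of_point hε₀ hC₀ hc0.le hc2 hI htI ?_⟩
  rw [norm_pvAnsatz, hlog, inv_smul_smul₀ hr.ne', ← rotZ_add, neg_add_cancel, rotZ_zero,
    ← mul_assoc, mul_inv_cancel₀ hr.ne', one_mul, ← hUs']
  exact hUy

/-! ### The extraction (normalised factors `c_n ≤ 2`) -/

/-- The extraction step below under the harmless normalisation `c_n ≤ 2` (true on a tail of any
sequence `c_n → 1`); see `rdssCompact_exists_limit` for the statement and the argument. -/
private theorem rdssCompact_exists_limit_of_le_two {C₀ α₀ : ℝ} {α c : ℕ → ℝ}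
    {U : ℕ → EuclideanSpace ℝ (Fin 3) → ℝ → EuclideanSpace ℝ (Fin 3)}
    {P : ℕ → ℝ → EuclideanSpace ℝ (Fin 3) → ℝ} (hC₀ : 0 < C₀) (hc1 : ∀ n, 1 < c n)
    (hc2 : ∀ n, c n ≤ 2) (hc : Tendsto c atTop (𝓝 1)) (hα : Tendsto α atTop (𝓝 α₀))
    (hper : ∀ (n : ℕ) (y : EuclideanSpace ℝ (Fin 3)) (s : ℝ),
      U n y (s + 2 * Real.log (c n)) = U n y s)
    (hcl : ∀ n, IsClassicalNSSolutionOn (Iio 0) 1 0 (pvAnsatz (α n) (U n)) (P n))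
    (hI : ∀ n, HasTypeIDecay C₀ (pvAnsatz (α n) (U n)))
    (hnt : ∀ n, ∃ t < 0, ∃ x : EuclideanSpace ℝ (Fin 3), pvAnsatz (α n) (U n) t x ≠ 0) :
    ∃ v : ℝ → EuclideanSpace ℝ (Fin 3) → EuclideanSpace ℝ (Fin 3), Continuous (uncurry v) ∧
      (∀ t ≤ -(1 / 4 : ℝ), ∀ x, ‖v t x‖ ≤ C₀ / (‖x‖ + √(-t))) ∧
      IsBoundedWeakNSSolutionOn (Iio 0) isOpen_Iio 1 (fun t => v (t - 1 / 4)) ∧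
      (∀ μ : ℝ, 1 ≤ μ → ∀ t ≤ -(1 / 4 : ℝ), ∀ x,
        v t x = μ • rotZ (α₀ * (2 * Real.log μ))
          (v (μ ^ 2 * t) (μ • rotZ (-(α₀ * (2 * Real.log μ))) x))) ∧
      ∃ x : EuclideanSpace ℝ (Fin 3), v (-1) x ≠ 0 := by
  -- adapted from Literature/Analysis/FluidPDE/ChaeWolfRemovingDSSLimit.lean (ChaeWolf.exists_limit)
  set w : ℕ → ℝ → EuclideanSpace ℝ (Fin 3) → EuclideanSpace ℝ (Fin 3) :=
    fun n => pvAnsatz (α n) (U n) with hw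
  obtain ⟨K, L, hK, hL, hKL⟩ := ChaeWolf.exists_uniform_lipschitz hC₀.le
  obtain ⟨ε₀, hε₀, hA⟩ := ChaeWolf.exists_eps_typeI_small_eq_zero
  -- Step 1: witnesses `t_n ∈ [-c_n², -1]`, `‖x_n‖ ≤ 2C₀/ε₀`, `‖w_n(t_n, x_n)‖ ≥ ε₀/2`
  have hwit : ∀ n, ∃ t ∈ Icc (-c n ^ 2) (-1), ∃ x : EuclideanSpace ℝ (Fin 3),
      ‖x‖ ≤ 2 * C₀ / ε₀ ∧ ε₀ / 2 ≤ ‖w n t x‖ := by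
    intro n
    -- a point with a large scale-invariant size, by the smallness lemma
    obtain ⟨t', ht', x', hq'⟩ : ∃ t' < 0, ∃ x', ε₀ < √(-t') * ‖w n t' x'‖ := by
      by_contra hcon
      push Not at hcon
      obtain ⟨t, ht, x, hx⟩ := hnt n
      exact hx (hA hC₀.le (hcl n) (hI n) hcon t ht x)
    exact rdssCompact_witness hε₀ hC₀.le (hc1 n) (hc2 n) (hper n) (hI n) ht' hq'
  -- the equi-Lipschitz family on `ℝ × ℝ³` (fields frozen at time `-1/4` for later times)
  set Kx : ℝ≥0 := (K + L).toNNReal with hKx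
  have hKx' : (Kx : ℝ) = K + L := by rw [hKx, Real.coe_toNNReal _ (by positivity)]
  set f : ℕ → ℝ × EuclideanSpace ℝ (Fin 3) → EuclideanSpace ℝ (Fin 3) :=
    fun n q => w n (min q.1 (-(1 / 4 : ℝ))) q.2 with hf
  have hf_of_le : ∀ n {t : ℝ} (_ : t ≤ -(1 / 4 : ℝ)) (x : EuclideanSpace ℝ (Fin 3)),
      f n (t, x) = w n t x :=
    fun n t ht x => by simp only [hf, min_eq_left ht]
  have hlip : ∀ n, LipschitzWith Kx (f n) := by
    intro n
    obtain ⟨hsp, htm⟩ := hKL (hcl n) (hI n)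
    refine LipschitzWith.of_dist_le_mul fun q q' => ?_
    rw [hKx', dist_eq_norm, Prod.dist_eq, Real.dist_eq, dist_eq_norm]
    have hm : min q.1 (-(1 / 4 : ℝ)) ≤ -(1 / 4 : ℝ) := min_le_right _ _
    have hm' : min q'.1 (-(1 / 4 : ℝ)) ≤ -(1 / 4 : ℝ) := min_le_right _ _
    have hmin : |min q.1 (-(1 / 4 : ℝ)) - min q'.1 (-(1 / 4 : ℝ))| ≤ |q.1 - q'.1| := by
      refine (abs_min_sub_min_le_max _ _ _ _).trans (max_le le_rfl ?_)
      rw [sub_self, abs_zero]; exact abs_nonneg _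
    calc ‖w n (min q.1 (-(1 / 4))) q.2 - w n (min q'.1 (-(1 / 4))) q'.2‖
        ≤ ‖w n (min q.1 (-(1 / 4))) q.2 - w n (min q.1 (-(1 / 4))) q'.2‖ +
            ‖w n (min q.1 (-(1 / 4))) q'.2 - w n (min q'.1 (-(1 / 4))) q'.2‖ :=
          norm_sub_le_norm_sub_add_norm_sub _ _ _
      _ ≤ K * ‖q.2 - q'.2‖ + L * |min q.1 (-(1 / 4 : ℝ)) - min q'.1 (-(1 / 4 : ℝ))| :=
          add_le_add (hsp _ hm _ _) (htm _ hm' _ hm _)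
      _ ≤ K * max |q.1 - q'.1| ‖q.2 - q'.2‖ + L * max |q.1 - q'.1| ‖q.2 - q'.2‖ := by
          gcongr
          · exact le_max_right _ _
          · exact hmin.trans (le_max_left _ _)
      _ = (K + L) * max |q.1 - q'.1| ‖q.2 - q'.2‖ := by ring
  have hball : ∀ n q, f n q ∈ closedBall (0 : EuclideanSpace ℝ (Fin 3)) (2 * C₀) :=
      fun n q => by
    rw [mem_closedBall, dist_zero_right]
    exact ChaeWolf.typeI_norm_le_two_mul hC₀.le (hI n) (min_le_right _ _) _
  obtain ⟨φ, l, hφ, hl, -, hlim⟩ := exists_strictMono_tendsto_of_lipschitzWith f hlip hball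
  -- the limit field
  set v : ℝ → EuclideanSpace ℝ (Fin 3) → EuclideanSpace ℝ (Fin 3) := fun t x => l (t, x) with hv
  have hlimv : ∀ {t : ℝ} (_ : t ≤ -(1 / 4 : ℝ)) (x : EuclideanSpace ℝ (Fin 3)),
      Tendsto (fun n => w (φ n) t x) atTop (𝓝 (v t x)) := by
    intro t ht x
    simpa only [hf_of_le _ ht] using hlim (t, x)
  have hvc : Continuous (uncurry v) := by
    have e : uncurry v = l := by funext q; rfl
    rw [e]; exact hl.continuous
  refine ⟨v, hvc, ?_, ?_, ?_, ?_⟩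
  · -- the Type I bound passes to the limit
    intro t ht x
    exact le_of_tendsto' (hlimv ht x).norm fun n => hI (φ n) t (by linarith) x
  · -- bounded weak solution on `(-∞, -1/4)`, shifted to `(-∞, 0)`
    have hA' : Tendsto (fun k : ℕ => -(k : ℝ) + -1) atTop atBot :=
      (tendsto_neg_atTop_atBot.comp tendsto_natCast_atTop_atTop).atBot_add tendsto_const_nhds
    have e14 : ∀ t : ℝ, t - 1 / 4 = t + -(1 / 4 : ℝ) := fun t => by ring
    have hV : ∀ k : ℕ, IsBoundedWeakNSSolutionOn (Ioo (-(k : ℝ) + -1) 0) isOpen_Ioo 1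
        (fun t => w (φ k) (t - 1 / 4)) := by
      intro k
      have hcl' : IsClassicalNSSolutionOn (Ioo (-(k : ℝ) + -1 + -(1 / 4)) (-(1 / 4))) 1 0
          (w (φ k)) (P (φ k)) :=
        (hcl (φ k)).mono (fun t ht => by simp only [mem_Iio]; linarith [ht.2])
          (uniqueDiffOn_Ioo _ _)
      have hbdd : IsBoundedOn (Ioo (-(k : ℝ) + -1 + -(1 / 4)) (-(1 / 4))) (w (φ k)) :=
        ⟨2 * C₀, fun t ht x => ChaeWolf.typeI_norm_le_two_mul hC₀.le (hI (φ k)) ht.2.le x⟩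
      have h := (hcl'.isBoundedWeakNSSolutionOn hbdd).comp_add_right (-(1 / 4 : ℝ))
        (J := Ioo (-(k : ℝ) + -1) 0) isOpen_Ioo fun t => by
          simp only [mem_Ioo]
          constructor <;> intro h <;> constructor <;> linarith [h.1, h.2]
      simpa only [e14] using h
    have hcont : ∀ k : ℕ, ContinuousOn (uncurry fun t => w (φ k) (t - 1 / 4))
        (Ioo (-(k : ℝ) + -1) 0 ×ˢ univ) := by
      intro k
      have h1 := ((hcl (φ k)).smooth_velocity.comp_add_right (-(1 / 4 : ℝ))).continuousOn
      refine (h1.mono (prod_mono (fun t ht => ?_) Subset.rfl)).congr fun q _ => by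
        simp only [uncurry, e14, hw]
      simp only [mem_preimage, mem_Iio]
      linarith [ht.2]
    have hbd : ∀ k : ℕ, ∀ t ∈ Ioo (-(k : ℝ) + -1) 0, ∀ x,
        ‖w (φ k) (t - 1 / 4) x‖ ≤ 2 * C₀ :=
      fun k t ht x => ChaeWolf.typeI_norm_le_two_mul hC₀.le (hI (φ k)) (by linarith [ht.2]) x
    have hvc' : Continuous (uncurry fun t x => v (t - 1 / 4) x) :=
      hvc.comp ((continuous_fst.sub continuous_const).prodMk continuous_snd)
    exact isBoundedWeakNSSolutionOn_of_tendsto hA' hV hcont hbd hvc'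
      fun t ht x => hlimv (by linarith) x
  · -- rotated self-similarity of the limit: moving factors `λ_n = c_n ^ k_n → μ`, moving angles
    intro μ hμ t ht x
    have hμ0 : 0 < μ := one_pos.trans_le hμ
    have ht0 : t ≤ 0 := by linarith
    choose k hk using fun n => exists_nat_pow_near hμ (hc1 n)
    set lam : ℕ → ℝ := fun n => c n ^ k n with hlam
    have hlam1 : ∀ n, 1 ≤ lam n := fun n => one_le_pow₀ (hc1 n).le
    have hlamμ : ∀ n, lam n ≤ μ := fun n => (hk n).1
    have hμlam : ∀ n, μ / c n ≤ lam n := fun n => by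
      rw [div_le_iff₀ (by linarith [hc1 n]), hlam, ← pow_succ]
      exact (hk n).2.le
    have hlam_lim : Tendsto lam atTop (𝓝 μ) := by
      have h0 : Tendsto (fun n => μ / c n) atTop (𝓝 μ) := by
        have h' := (tendsto_const_nhds (x := μ)).div hc one_ne_zero
        rw [div_one] at h'
        exact h'.congr fun n => rfl
      exact tendsto_of_tendsto_of_tendsto_of_le_of_le h0 tendsto_const_nhds hμlam hlamμ
    have hlamφ : Tendsto (lam ∘ φ) atTop (𝓝 μ) := hlam_lim.comp hφ.tendsto_atTop
    set θ₀ : ℝ := α₀ * (2 * Real.log μ) with hθ₀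
    set θ : ℕ → ℝ := fun n => α n * (2 * Real.log (lam n)) with hθ
    have hθlim : Tendsto (fun n => θ (φ n)) atTop (𝓝 θ₀) :=
      (hα.comp hφ.tendsto_atTop).mul ((hlamφ.log hμ0.ne').const_mul 2)
    -- the twisted scaling identities along the sequence
    have hid : ∀ n, w n t x =
        lam n • rotZ (θ n) (w n (lam n ^ 2 * t) (lam n • rotZ (-(θ n)) x)) := fun n =>
      rdssCompact_pvAnsatz_eq_smul_rotZ_pow (α n) (one_pos.trans (hc1 n)) (hper n) (k n) t x
    -- the moving points stay in `t ≤ -1/4`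
    have hmem : ∀ s : ℝ, 1 ≤ s → s ^ 2 * t ≤ -(1 / 4 : ℝ) := fun s hs =>
      (mul_le_of_one_le_left ht0 (one_le_pow₀ hs)).trans ht
    have hrot : Tendsto (fun n => rotZ (-(θ (φ n))) x) atTop (𝓝 (rotZ (-θ₀) x)) :=
      rssCompact_tendsto_rotZ_of_tendsto hθlim.neg tendsto_const_nhds
    set q : ℕ → ℝ × EuclideanSpace ℝ (Fin 3) :=
      fun n => (lam (φ n) ^ 2 * t, lam (φ n) • rotZ (-(θ (φ n))) x) with hq
    have hqlim : Tendsto q atTop (𝓝 (μ ^ 2 * t, μ • rotZ (-θ₀) x)) :=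
      ((hlamφ.pow 2).mul_const t).prodMk_nhds (hlamφ.smul hrot)
    have h1 : Tendsto (fun n => f (φ n) (q n)) atTop
        (𝓝 (v (μ ^ 2 * t) (μ • rotZ (-θ₀) x))) :=
      ChaeWolf.tendsto_apply_of_tendsto (fun n => hlip (φ n)) hqlim
        (hlim (μ ^ 2 * t, μ • rotZ (-θ₀) x))
    have h1' : Tendsto (fun n => w (φ n) (lam (φ n) ^ 2 * t) (lam (φ n) • rotZ (-(θ (φ n))) x))
        atTop (𝓝 (v (μ ^ 2 * t) (μ • rotZ (-θ₀) x))) := by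
      refine h1.congr fun n => ?_
      simp only [hq, hf_of_le _ (hmem _ (hlam1 _))]
    have h2 := rssCompact_tendsto_rotZ_of_tendsto hθlim h1'
    have h3 : Tendsto (fun n => w (φ n) t x) atTop
        (𝓝 (μ • rotZ θ₀ (v (μ ^ 2 * t) (μ • rotZ (-θ₀) x)))) := by
      refine (hlamφ.smul h2).congr fun n => ?_
      exact (hid (φ n)).symm
    exact tendsto_nhds_unique (hlimv ht x) h3
  · -- nontriviality at time `-1`: the witnesses accumulate at a point `(-1, x̄)`
    choose tw htw xw hxw hnw using hwit
    set S : Set (ℝ × EuclideanSpace ℝ (Fin 3)) :=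
      Icc (-4 : ℝ) (-1) ×ˢ closedBall (0 : EuclideanSpace ℝ (Fin 3)) (2 * C₀ / ε₀) with hS
    have hSc : IsCompact S := isCompact_Icc.prod (isCompact_closedBall _ _)
    have hmemS : ∀ n, (tw (φ n), xw (φ n)) ∈ S := fun n => by
      refine mk_mem_prod ⟨?_, (htw (φ n)).2⟩ ?_
      · have : c (φ n) ^ 2 ≤ 4 := by nlinarith [hc2 (φ n), hc1 (φ n)]
        linarith [(htw (φ n)).1]
      · rw [mem_closedBall, dist_zero_right]; exact hxw (φ n)
    obtain ⟨⟨tbar, xbar⟩, -, ψ, hψ, hconv⟩ := hSc.tendsto_subseq hmemS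
    -- the limit time is `-1`
    have ht1 : Tendsto (fun n => tw (φ (ψ n))) atTop (𝓝 (-1)) := by
      have hlow : Tendsto (fun n => -(c (φ (ψ n))) ^ 2) atTop (𝓝 (-1)) := by
        have := ((hc.comp hφ.tendsto_atTop).comp hψ.tendsto_atTop).pow 2
        simpa using this.neg
      exact tendsto_of_tendsto_of_tendsto_of_le_of_le hlow tendsto_const_nhds
        (fun n => (htw _).1) fun n => (htw _).2
    have htbar : tbar = -1 :=
      tendsto_nhds_unique ((continuous_fst.tendsto _).comp hconv) ht1
    subst htbar
    refine ⟨xbar, fun h0 => ?_⟩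
    -- `w_{φ ψ n}(t_n, x_n) → v(-1, xbar)`
    have h14 : (-1 : ℝ) ≤ -(1 / 4 : ℝ) := by norm_num
    have hy : Tendsto (fun n => f (φ (ψ n)) ((-1 : ℝ), xbar)) atTop (𝓝 (v (-1) xbar)) :=
      (hlim ((-1 : ℝ), xbar)).comp hψ.tendsto_atTop
    have hmain := ChaeWolf.tendsto_apply_of_tendsto (fun n => hlip (φ (ψ n))) hconv hy
    have hge : ε₀ / 2 ≤ ‖v (-1) xbar‖ := by
      refine ge_of_tendsto' hmain.norm fun n => ?_
      simp only [comp_apply, hf_of_le _ ((htw _).2.trans h14)]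
      exact hnw (φ (ψ n))
    rw [h0, norm_zero] at hge
    linarith

/-! ### The extraction -/

/-- **The compactness step for Type I RDSS solutions (Chae–Wolf 2017, §3, Steps 1–2, run with
rotations `α_n → α₀` and factors `c_n → 1`).** Let `w_n = pvAnsatz α_n U_n` be the RDSS ansatz
fields (1.13a) with speeds `α_n → α₀` and `s`-periodic profiles `U_n` of periods `2 log c_n`,
`1 < c_n → 1`, each a classical Navier–Stokes solution (`ν = 1`, `f = 0`) on `ℝ³ × (−∞, 0)`
obeying the common Type I bound `‖w_n(t,x)‖ ≤ C₀/(‖x‖ + √(−t))` and not identically zero. Then a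
subsequence converges, locally uniformly on `(−∞, −1/4] × ℝ³` (uniform Lipschitz bounds
`ChaeWolf.exists_uniform_lipschitz` and the pointwise Arzelà–Ascoli theorem
`exists_strictMono_tendsto_of_lipschitzWith`), to a continuous field `v` with the same Type I
bound, which is a bounded weak Navier–Stokes solution on `(−∞, −1/4)` (written for
`t ↦ v(t − 1/4)` on `(−∞, 0)`), is **rotated self-similar with speed `α₀`** —
`v(t,x) = μ R(θ₀) v(μ²t, μ R(−θ₀) x)`, `θ₀ = 2α₀ log μ`, for every `μ ≥ 1`: with
`λ_n = c_n^{k_n}`, `k_n = ⌊log μ / log c_n⌋`, one has `μ/c_n < λ_n ≤ μ`, so `λ_n → μ`, and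
`w_n(t,x) = λ_n R(θ_n) w_n(λ_n²t, λ_n R(−θ_n) x)` with `θ_n = 2α_n log λ_n → θ₀`
(`isRotatedDSS_pvAnsatz` at the factor `c_n^{k_n}`, equicontinuity,
`rssCompact_tendsto_rotZ_of_tendsto`) — and **nontrivial at time `−1`** (on a tail with
`c_n ≤ 2`: the smallness lemma `ChaeWolf.exists_eps_typeI_small_eq_zero`, the size identity
`√(−t)|w_n(t,x)| = |U_n(y,s)|`, periodicity in `s` and the Type I bound give witnesses
`t_n ∈ [−c_n², −1]`, `‖x_n‖ ≤ 2C₀/ε₀`, `‖w_n(t_n,x_n)‖ ≥ ε₀/2`, which accumulate at a point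
`(−1, x̄)` with `‖v(−1, x̄)‖ ≥ ε₀/2`). -/
theorem rdssCompact_exists_limit : ∀ (C₀ α₀ : ℝ) (α c : ℕ → ℝ)
    (U : ℕ → EuclideanSpace ℝ (Fin 3) → ℝ → EuclideanSpace ℝ (Fin 3))
    (P : ℕ → ℝ → EuclideanSpace ℝ (Fin 3) → ℝ), 0 < C₀ → (∀ n, 1 < c n) →
    Filter.Tendsto c Filter.atTop (nhds 1) → Filter.Tendsto α Filter.atTop (nhds α₀) →
    (∀ (n : ℕ) (y : EuclideanSpace ℝ (Fin 3)) (s : ℝ),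
      U n y (s + 2 * Real.log (c n)) = U n y s) →
    (∀ n, Literature.Analysis.FluidPDE.IsClassicalNSSolutionOn (Set.Iio 0) 1 0
      (Literature.Analysis.FluidPDE.pvAnsatz (α n) (U n)) (P n)) →
    (∀ n, Literature.Analysis.FluidPDE.HasTypeIDecay C₀
      (Literature.Analysis.FluidPDE.pvAnsatz (α n) (U n))) →
    (∀ n, ∃ t < 0, ∃ x : EuclideanSpace ℝ (Fin 3),
      Literature.Analysis.FluidPDE.pvAnsatz (α n) (U n) t x ≠ 0) →
    ∃ v : ℝ → EuclideanSpace ℝ (Fin 3) → EuclideanSpace ℝ (Fin 3),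
      Continuous (Function.uncurry v) ∧
      (∀ t ≤ -(1 / 4 : ℝ), ∀ x : EuclideanSpace ℝ (Fin 3),
        ‖v t x‖ ≤ C₀ / (‖x‖ + Real.sqrt (-t))) ∧
      Literature.Analysis.FluidPDE.IsBoundedWeakNSSolutionOn (Set.Iio 0) isOpen_Iio 1
        (fun t => v (t - 1 / 4)) ∧
      (∀ μ : ℝ, 1 ≤ μ → ∀ t ≤ -(1 / 4 : ℝ), ∀ x : EuclideanSpace ℝ (Fin 3),
        v t x = μ • Literature.Analysis.FluidPDE.rotZ (α₀ * (2 * Real.log μ))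
          (v (μ ^ 2 * t)
            (μ • Literature.Analysis.FluidPDE.rotZ (-(α₀ * (2 * Real.log μ))) x))) ∧
      ∃ x : EuclideanSpace ℝ (Fin 3), v (-1) x ≠ 0 := by
  intro C₀ α₀ α c U P hC₀ hc1 hc hα hper hcl hI hnt
  -- pass to a tail of the sequence on which `c n ≤ 2` (the conclusion only sees the limits)
  obtain ⟨N, hN⟩ :=
    eventually_atTop.1 (hc.eventually (Iic_mem_nhds (by norm_num : (1 : ℝ) < 2)))
  exact rdssCompact_exists_limit_of_le_two (α := fun n => α (n + N)) (c := fun n => c (n + N))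
    (U := fun n => U (n + N)) (P := fun n => P (n + N)) hC₀ (fun n => hc1 _)
    (fun n => hN _ (N.le_add_left n)) ((tendsto_add_atTop_iff_nat N).2 hc)
    ((tendsto_add_atTop_iff_nat N).2 hα) (fun n => hper _) (fun n => hcl _) (fun n => hI _)
    fun n => hnt _

end Summit.NavierStokesRegularity.NavierStokesRegularity.Theorems

end
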